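import Literature.AlgebraicGeometry.Resolution.FlatLocalRegularAscent
import Mathlib.RingTheory.Unramified.Field
import Mathlib.RingTheory.Ideal.MinimalPrime.Localization
import Mathlib.RingTheory.IntegralClosure.Algebra.Basic
import Mathlib.RingTheory.Ideal.GoingUp
import Mathlib.RingTheory.Localization.FractionRing
import Mathlib.LinearAlgebra.TensorProduct.RightExactness
import Mathlib.LinearAlgebra.TensorProduct.Finiteness
import HarnessLib

/-!
# Regularity ascends along flat local homomorphisms whose closed fibre is a separable
# algebraic residue extension (Matsumura 23.7 (ii), separable-residue case)

Topic: `Literature/AlgebraicGeometry/Resolution`. Local algebra for Lipman 1969, Lemma (16.1) (ii)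
("`Z = Y ⊗_A B` is regular", p. 232) in the local-étale case typed in
`Lipman1969FormallySmoothBaseChange`: the separable-residue-field analogue of
`isRegularLocalRing_localization_tensor_of_closedFibre` (file `FlatLocalRegularAscent`, the
trivial-residue case). Everything is PROVED; no definitions, no named facts.

* `isReduced_tensorProduct_of_isSeparable'` — **EGA IV₂ (4.3.5)**: `L ⊗_k K` is reduced for
  `K/k` separable algebraic of any degree and `L/k` any field extension (finite case = Mathlib
  `Algebra.FormallyUnramified.isReduced_of_field`; general case by finitely generated
  subextensions and flatness over `k`).
* `isReduced_tensorProduct_of_isSeparable_of_isDomain` — **EGA IV₂ (4.6.1)**: the same with `L`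
  replaced by a domain `R` (embed `R ⊗_k K ↪ Frac(R) ⊗_k K`).
* `exists_not_mem_and_mul_eq_zero_of_mem_minimalPrimes` — **Stacks 00EU**: in a reduced ring a
  minimal prime `p` is killed by localising at `p`.
* (private) `exists_not_mem_and_mul_eq_zero_of_comap_eq_bot` — for `R` a domain over the field
  `k` and `K/k` separable algebraic, a prime `P` of `R ⊗_k K` with `P ∩ R = 0` is minimal
  (incomparability, `R ⊗_k K` being integral over `R`), hence "locally zero".
* `isRegularLocalRing_localization_tensor_of_isSeparable` — **Matsumura 23.7 (ii)** for the flat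
  local homomorphism `B_𝔶 → (B ⊗_D E)_𝔷`: `D → E` flat local with `𝔪_D E = 𝔪_E` and `κ(E)/κ(D)`
  separable algebraic, `𝔷 ⊇ 1 ⊗ 𝔪_E`, `𝔶 = 𝔷 ∩ B`; the closed fibre is a localisation of
  `κ(𝔶) ⊗_{κ(D)} κ(E)` at a prime, a field by the above, so `𝔶 (B ⊗_D E)_𝔷` is the maximal ideal
  and `IsRegularLocalRing.of_flat_of_map_maximalIdeal_eq` applies.

## Sources

* H. Matsumura, *Commutative Ring Theory*, CUP 1986, Thm. 23.7 (ii) (p. 182). [Matsumura1987]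
* A. Grothendieck, J. Dieudonné, EGA IV₂ (Publ. Math. IHÉS 24, 1965), Prop. (4.3.5) (p. 58),
  Prop. (4.6.1) (p. 68) (separable ⇒ geometrically reduced). [GrothendieckDieudonne1965]
* The Stacks Project, Tag 00EU (localisation of a reduced ring at a minimal prime is a field).
  [StacksProject]
* J. Lipman, *Rational singularities…*, Publ. Math. IHÉS 36 (1969), Lemma (16.1) (ii), proof
  p. 232 (the application). [Lipman1969]
-/

noncomputable section

open IsLocalRing TensorProduct

namespace Literature.AlgebraicGeometry.Resolution

universe u v w

/-! ## Separable algebraic extensions are geometrically reduced (EGA IV₂ (4.6.1)) -/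

/-- **EGA IV₂ (4.3.5), finite case**: for `K/k` finite separable and any field extension `L/k`,
`L ⊗_k K` is reduced (a finite separable extension is formally unramified, and an unramified
algebra essentially of finite type over the field `L` is reduced — Mathlib).
[cite: GrothendieckDieudonne1965, Prop. (4.3.5) (p. 58)] -/
theorem isReduced_tensorProduct_of_isSeparable_of_finiteDimensional' (k : Type u) (K : Type v)
    (L : Type w) [Field k] [Field K] [Field L] [Algebra k K] [Algebra k L]
    [Algebra.IsSeparable k K] [FiniteDimensional k K] : IsReduced (L ⊗[k] K) := by
  haveI : Algebra.FormallyUnramified k K := Algebra.FormallyUnramified.of_isSeparable k K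
  exact Algebra.FormallyUnramified.isReduced_of_field L (L ⊗[k] K)

/-- **EGA IV₂ (4.3.5)** ("Soient `K`, `L` deux extensions d'un corps `k`. Si `L` est une extension
séparable de `k`, l'anneau `L ⊗_k K` est réduit."), here with the separable factor written on the
right: for `K/k` separable algebraic of ANY degree and any field extension `L/k`, `L ⊗_k K` is
reduced. A nilpotent `x = Σ lᵢ ⊗ κᵢ` lies in the image of `L ⊗_k K₀`,
`K₀ = k(κ₁, …, κ_r)` finite separable; `L ⊗_k K₀ → L ⊗_k K` is injective (`L` is flat over the
field `k`), so the preimage is nilpotent in the reduced ring `L ⊗_k K₀`, hence zero.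
(Adapted from the programme's `IsoTailsHS.isReduced_tensorProduct_of_isSeparable`, Summits side.)
[cite: GrothendieckDieudonne1965, Prop. (4.3.5) (p. 58)] -/
theorem isReduced_tensorProduct_of_isSeparable' (k : Type u) (K : Type v) (L : Type w) [Field k]
    [Field K] [Field L] [Algebra k K] [Algebra k L] [Algebra.IsSeparable k K] :
    IsReduced (L ⊗[k] K) := by
  classical
  refine ⟨fun x hx => ?_⟩
  obtain ⟨S, rfl⟩ := TensorProduct.exists_finset x
  -- the statement for an arbitrary finite intermediate field containing the right legs
  have key : ∀ (K₀ : IntermediateField k K), FiniteDimensional k K₀ → (∀ p ∈ S, p.2 ∈ K₀) →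
      (∑ p ∈ S, p.1 ⊗ₜ[k] p.2 : L ⊗[k] K) = 0 := by
    intro K₀ _ hmem
    let f := Algebra.TensorProduct.map (AlgHom.id k L) K₀.val
    let y : L ⊗[k] K₀ := ∑ p ∈ S.attach, p.1.1 ⊗ₜ[k] (⟨p.1.2, hmem p.1 p.2⟩ : K₀)
    have hfy : f y = ∑ p ∈ S, p.1 ⊗ₜ[k] p.2 := by
      simp only [y, f, map_sum, Algebra.TensorProduct.map_tmul, AlgHom.coe_id, id_eq,
        IntermediateField.val_mk]
      exact Finset.sum_attach S fun p => p.1 ⊗ₜ[k] p.2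
    -- `f` is injective: `L` is flat over the field `k`
    have hf : Function.Injective f := by
      have h : Function.Injective ((K₀.val.toLinearMap).lTensor L) :=
        Module.Flat.lTensor_preserves_injective_linearMap (M := L) K₀.val.toLinearMap
          Subtype.val_injective
      intro a b hab
      exact h hab
    haveI : IsReduced (L ⊗[k] K₀) :=
      isReduced_tensorProduct_of_isSeparable_of_finiteDimensional' k K₀ L
    obtain ⟨n, hn⟩ := hx
    have hfn : f (y ^ n) = f 0 := by rw [map_pow f y n, hfy, hn, map_zero]
    have hy : y = 0 := IsNilpotent.eq_zero ⟨n, hf hfn⟩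
    rw [← hfy, hy, map_zero]
  refine key (IntermediateField.adjoin k ((S.image Prod.snd : Finset K) : Set K))
    (IntermediateField.finiteDimensional_adjoin fun l _ => Algebra.IsIntegral.isIntegral l)
    fun p hp => ?_
  exact IntermediateField.subset_adjoin k _ (Finset.mem_coe.mpr (Finset.mem_image_of_mem Prod.snd hp))

/-- **EGA IV₂ (4.6.1) e) ⇒ a)** for `X = Spec K`, `S = Spec R`: `R ⊗_k K` is reduced for `R` a
domain over the field `k` and `K/k` separable algebraic — `R ⊗_k K ↪ Frac(R) ⊗_k K` (`K` is flat
over `k`) and the latter is reduced by (4.3.5) (`isReduced_tensorProduct_of_isSeparable'`), which is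
the printed proof. [cite: GrothendieckDieudonne1965, Prop. (4.6.1) (p. 68)] -/
theorem isReduced_tensorProduct_of_isSeparable_of_isDomain (k : Type u) (K : Type v) (R : Type w)
    [Field k] [Field K] [CommRing R] [IsDomain R] [Algebra k K] [Algebra k R]
    [Algebra.IsSeparable k K] : IsReduced (R ⊗[k] K) := by
  let L := FractionRing R
  let φ : R →ₐ[k] L := IsScalarTower.toAlgHom k R L
  have hφ : Function.Injective φ := IsFractionRing.injective R L
  let ψ := Algebra.TensorProduct.map φ (AlgHom.id k K)
  have hψ : Function.Injective ψ := by
    have h : Function.Injective ((φ.toLinearMap).rTensor K) :=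
      Module.Flat.rTensor_preserves_injective_linearMap (M := K) φ.toLinearMap hφ
    intro a b hab
    exact h hab
  haveI : IsReduced (L ⊗[k] K) := isReduced_tensorProduct_of_isSeparable' k K L
  exact isReduced_of_injective ψ hψ

/-! ## Minimal primes of reduced rings; primes of `R ⊗_k K` over `(0)` -/

/-- **Stacks 00EU** ("Let `𝔭` be a minimal prime of a ring `R`. Every element of the maximal ideal
of `R_𝔭` is nilpotent. If `R` is reduced then `R_𝔭` is a field."), in the elementwise form used
here: in a reduced ring, a minimal prime `p` is killed by localisation at `p` — every `x ∈ p` has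
`s x = 0` for some `s ∉ p`. (Proof as in the F-83 skeleton of res-inputs-crit-1.)
[cite: StacksProject, Tag 00EU] -/
theorem exists_not_mem_and_mul_eq_zero_of_mem_minimalPrimes {R : Type*} [CommRing R] [IsReduced R]
    {p : Ideal R} (hp : p ∈ minimalPrimes R) {x : R} (hx : x ∈ p) : ∃ s ∉ p, s * x = 0 := by
  haveI : p.IsPrime := hp.1.1
  have hrad :=
    IsLocalization.AtPrime.radical_map_of_mem_minimalPrimes (Localization.AtPrime p) p ⊥ hp
  have hx' : algebraMap R (Localization.AtPrime p) x ∈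
      (Ideal.map (algebraMap R (Localization.AtPrime p)) ⊥).radical := by
    rw [hrad]; exact Ideal.mem_map_of_mem _ hx
  rw [Ideal.map_bot] at hx'
  obtain ⟨n, hn⟩ := hx'
  rw [Ideal.mem_bot, ← map_pow, IsLocalization.map_eq_zero_iff p.primeCompl] at hn
  obtain ⟨⟨s, hs⟩, hsn⟩ := hn
  refine ⟨s, hs, ?_⟩
  have hnil : IsNilpotent (s * x) :=
    ⟨n + 1, by rw [show (s * x) ^ (n + 1) = (s ^ n * x) * (s * x ^ n) by ring, hsn, mul_zero]⟩
  exact hnil.eq_zero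

/-- **Primes of `R ⊗_k K` over `(0)` are locally zero.** For `R` a domain over the field `k`,
`K/k` separable algebraic and `P` a prime of `R ⊗_k K` with `P ∩ R = 0`: `P` is a minimal prime
(`R ⊗_k K` is integral over `R`, incomparability) of a reduced ring
(`isReduced_tensorProduct_of_isSeparable_of_isDomain`), so every `x ∈ P` has `s x = 0` for some
`s ∉ P` — i.e. `(R ⊗_k K)_P` is the localisation of the reduced zero-dimensional ring
`Frac(R) ⊗_k K` at a prime, a field. Private helper of
`isRegularLocalRing_localization_tensor_of_isSeparable`. [folklore] -/
private theorem exists_not_mem_and_mul_eq_zero_of_comap_eq_bot {k : Type u} {K : Type v} {R : Type w}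
    [Field k] [Field K] [CommRing R] [IsDomain R] [Algebra k K] [Algebra k R]
    [Algebra.IsSeparable k K] (P : Ideal (R ⊗[k] K)) [P.IsPrime]
    (hP : P.comap (algebraMap R (R ⊗[k] K)) = ⊥) {x : R ⊗[k] K} (hx : x ∈ P) :
    ∃ s ∉ P, s * x = 0 := by
  haveI := isReduced_tensorProduct_of_isSeparable_of_isDomain k K R
  refine exists_not_mem_and_mul_eq_zero_of_mem_minimalPrimes ?_ hx
  haveI : Algebra.IsIntegral R (R ⊗[k] K) := Algebra.IsIntegral.tensorProduct k R K
  rw [minimalPrimes_eq_minimals]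
  refine ⟨‹P.IsPrime›, fun Q hQ hQP => ?_⟩
  by_contra hPQ
  obtain ⟨y, hyP, hyQ⟩ := SetLike.not_le_iff_exists.mp hPQ
  haveI := hQ
  have hlt := Ideal.comap_lt_comap_of_integral_mem_sdiff (R := R) hQP ⟨hyP, hyQ⟩
    (Algebra.IsIntegral.isIntegral y)
  rw [hP] at hlt
  exact not_lt_bot hlt

/-! ## Matsumura 23.7 (ii) with separable algebraic residue extension -/

/-- **The base change `B ⊗_D E` is regular over the closed point of `E`** (separable-residue
analogue of `isRegularLocalRing_localization_tensor_of_closedFibre`). Let `D → E` be a flat local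
homomorphism of local rings with `𝔪_D E = 𝔪_E` and `κ(E)/κ(D)` separable algebraic, `B` a
`D`-algebra with `B ⊗_D E` Noetherian, `𝔷 ⊇ 1 ⊗ 𝔪_E` a prime of `B ⊗_D E` and `𝔶 = 𝔷 ∩ B`. If
`B_𝔶` is a regular local ring then so is `(B ⊗_D E)_𝔷`: the local homomorphism
`B_𝔶 → (B ⊗_D E)_𝔷` is flat, and `𝔶 (B ⊗_D E)_𝔷` is the maximal ideal because
`(B ⊗_D E)/(𝔶, 𝔪_E) ≅ κ(𝔶)-domain (B/𝔶) ⊗_{κ(D)} κ(E)` has the prime `𝔷̄` lying over `(0)` of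
`B/𝔶`, which is locally zero (`exists_not_mem_and_mul_eq_zero_of_comap_eq_bot`); then
Matsumura Thm. 23.7 (ii) (`IsRegularLocalRing.of_flat_of_map_maximalIdeal_eq`) applies. This is
the ring-theoretic step of Lipman 1969, Lemma (16.1) (ii) ("`Z` is regular", p. 232: the fibre of
`𝒪_{Y,y} → 𝒪_{Z,z}` is a field). [cite: Matsumura1987, Thm. 23.7] -/
theorem isRegularLocalRing_localization_tensor_of_isSeparable {D E : Type u} [CommRing D]
    [CommRing E] [IsLocalRing D] [IsLocalRing E] [Algebra D E] [IsLocalHom (algebraMap D E)]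
    [Module.Flat D E]
    (hmax : (maximalIdeal D).map (algebraMap D E) = maximalIdeal E)
    [Algebra.IsSeparable (ResidueField D) (ResidueField E)]
    {B : Type u} [CommRing B] [Algebra D B] [IsNoetherianRing (B ⊗[D] E)]
    (𝔷 : Ideal (B ⊗[D] E)) [𝔷.IsPrime]
    (h𝔷 : maximalIdeal E ≤ 𝔷.comap
      (Algebra.TensorProduct.includeRight (R := D) (A := B) (B := E)).toRingHom)
    (hreg : IsRegularLocalRing (Localization.AtPrime (𝔷.comap (algebraMap B (B ⊗[D] E))))) :
    IsRegularLocalRing (Localization.AtPrime 𝔷) := by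
  set T := B ⊗[D] E
  set incR := (Algebra.TensorProduct.includeRight (R := D) (A := B) (B := E)).toRingHom
    with hincR
  set 𝔶 := 𝔷.comap (algebraMap B T) with h𝔶
  set k := ResidueField D
  set K := ResidueField E
  -- (K0) `𝔪_D B ⊆ 𝔶`, so `𝔶` lies over `𝔪_D`
  have h𝔪D : ∀ d ∈ maximalIdeal D, algebraMap D B d ∈ 𝔶 := fun d hd => by
    rw [h𝔶, Ideal.mem_comap, ← IsScalarTower.algebraMap_apply,
      ← (Algebra.TensorProduct.includeRight (R := D) (A := B) (B := E)).commutes d]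
    exact h𝔷 (hmax ▸ Ideal.mem_map_of_mem (algebraMap D E) hd)
  have h𝔶D : 𝔶.comap (algebraMap D B) = maximalIdeal D :=
    ((IsLocalRing.maximalIdeal.isMaximal D).eq_of_le
      (Ideal.IsPrime.ne_top inferInstance) fun d hd => h𝔪D d hd).symm
  haveI h𝔶over : 𝔶.LiesOver (maximalIdeal D) := ⟨h𝔶D.symm⟩
  -- the domain `R = B/𝔶` as a `κ(D)`-algebra
  set R := B ⧸ 𝔶
  letI algkR : Algebra k R := Ideal.Quotient.algebraOfLiesOver 𝔶 (maximalIdeal D)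
  haveI towDkR : IsScalarTower D k R := Ideal.Quotient.isScalarTower_of_liesOver D 𝔶 (maximalIdeal D)
  -- the surjection `Ψ : B ⊗_D E → (B/𝔶) ⊗_{κ(D)} κ(E)`
  let qB : B →ₐ[D] R := Ideal.Quotient.mkₐ D 𝔶
  let qE : E →ₐ[D] K := IsScalarTower.toAlgHom D E K
  have hqB : Function.Surjective qB := Ideal.Quotient.mkₐ_surjective D 𝔶
  have hqE : Function.Surjective qE := fun x => by
    obtain ⟨e, he⟩ := IsLocalRing.residue_surjective x
    exact ⟨e, he⟩
  have hkerB : RingHom.ker qB = 𝔶 := Ideal.Quotient.mkₐ_ker D 𝔶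
  have hkerE : RingHom.ker qE = maximalIdeal E := by
    ext e
    rw [RingHom.mem_ker]
    exact IsLocalRing.residue_eq_zero_iff e
  let Ψ₁ : T →ₐ[D] R ⊗[D] K := Algebra.TensorProduct.map qB qE
  have hΨ₁ : Function.Surjective Ψ₁ := Algebra.TensorProduct.map_surjective qB qE hqB hqE
  haveI : TensorProduct.CompatibleSMul D k R K := ⟨fun κ r x => by
    obtain ⟨d, rfl⟩ := IsLocalRing.residue_surjective κ
    rw [show IsLocalRing.residue D d = algebraMap D k d from rfl, algebraMap_smul,
      algebraMap_smul, TensorProduct.smul_tmul]⟩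
  let Ψ₂ : R ⊗[D] K ≃ₐ[D] R ⊗[k] K := Algebra.TensorProduct.equivOfCompatibleSMul k D D R K
  let Ψ : T →+* R ⊗[k] K := ((Ψ₂ : R ⊗[D] K →ₐ[D] R ⊗[k] K).comp Ψ₁).toRingHom
  have hΨapply : ∀ x, Ψ x = Ψ₂ (Ψ₁ x) := fun x => rfl
  have hΨ : Function.Surjective Ψ := fun z => by
    obtain ⟨y, rfl⟩ := Ψ₂.surjective z
    obtain ⟨x, rfl⟩ := hΨ₁ y
    exact ⟨x, hΨapply x⟩
  have hΨtmul : ∀ (b : B) (e : E),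
      Ψ (b ⊗ₜ[D] e) = (Ideal.Quotient.mk 𝔶 b) ⊗ₜ[k] (IsLocalRing.residue E e) := fun b e => rfl
  -- kernel of `Ψ`
  have hkerΨ : RingHom.ker Ψ = RingHom.ker Ψ₁ := by
    ext x
    rw [RingHom.mem_ker, RingHom.mem_ker, hΨapply]
    exact map_eq_zero_iff Ψ₂ Ψ₂.injective
  have hker₁ : RingHom.ker Ψ₁ =
      𝔶.map (Algebra.TensorProduct.includeLeft : B →ₐ[D] T) ⊔
        (maximalIdeal E).map (Algebra.TensorProduct.includeRight : E →ₐ[D] T) := by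
    rw [Algebra.TensorProduct.map_ker qB qE hqB hqE, hkerB, hkerE]
  have hE𝔶 : (maximalIdeal E).map (Algebra.TensorProduct.includeRight : E →ₐ[D] T) ≤
      𝔶.map (algebraMap B T) := by
    refine Ideal.map_le_iff_le_comap.mpr fun e he => ?_
    rw [← hmax] at he
    refine Submodule.span_induction ?_ ?_ ?_ ?_ he
    · rintro _ ⟨d, hd, rfl⟩
      rw [Ideal.mem_comap]
      have h1 : (Algebra.TensorProduct.includeRight : E →ₐ[D] T) (algebraMap D E d) =
          algebraMap B T (algebraMap D B d) := by
        rw [AlgHom.commutes, IsScalarTower.algebraMap_apply D B T]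
      rw [h1]
      exact Ideal.mem_map_of_mem _ (h𝔪D d hd)
    · exact Ideal.zero_mem _
    · intro a b _ _ ha hb
      exact Ideal.add_mem _ ha hb
    · intro c a _ ha
      exact Ideal.mul_mem_left _ c ha
  have hker𝔶 : RingHom.ker Ψ ≤ 𝔶.map (algebraMap B T) := by
    rw [hkerΨ, hker₁]
    refine sup_le (Ideal.map_le_iff_le_comap.mpr fun b hb => ?_) hE𝔶
    exact Ideal.mem_map_of_mem (algebraMap B T) hb
  have hker𝔷 : RingHom.ker Ψ ≤ 𝔷 :=
    hker𝔶.trans (Ideal.map_le_iff_le_comap.mpr le_rfl)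
  -- the prime `P = Ψ(𝔷)` of `R ⊗_k K` lies over `(0)` of `R`
  haveI hP : (𝔷.map Ψ).IsPrime := Ideal.map_isPrime_of_surjective hΨ hker𝔷
  have hcomapP : (𝔷.map Ψ).comap Ψ = 𝔷 := by
    rw [Ideal.comap_map_of_surjective Ψ hΨ, sup_eq_left]
    exact hker𝔷
  have hPbot : (𝔷.map Ψ).comap (algebraMap R (R ⊗[k] K)) = ⊥ := by
    rw [eq_bot_iff]
    intro r hr
    obtain ⟨b, rfl⟩ := Ideal.Quotient.mk_surjective r
    rw [Ideal.mem_comap] at hr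
    have h1 : algebraMap R (R ⊗[k] K) (Ideal.Quotient.mk 𝔶 b) = Ψ (algebraMap B T b) := by
      rw [Algebra.TensorProduct.algebraMap_apply, Algebra.TensorProduct.algebraMap_apply,
        Algebra.algebraMap_self_apply, Algebra.algebraMap_self_apply, hΨtmul, map_one]
    rw [h1, ← Ideal.mem_comap, hcomapP] at hr
    rw [Ideal.mem_bot, Ideal.Quotient.eq_zero_iff_mem]
    exact hr
  -- KEY: `𝔷 (B ⊗_D E)_𝔷 = 𝔶 (B ⊗_D E)_𝔷`
  have key : ∀ x ∈ 𝔷, ∃ s ∉ 𝔷, s * x ∈ 𝔶.map (algebraMap B T) := by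
    intro x hx
    have hΨx : Ψ x ∈ 𝔷.map Ψ := Ideal.mem_map_of_mem Ψ hx
    obtain ⟨σ, hσ, hσx⟩ := exists_not_mem_and_mul_eq_zero_of_comap_eq_bot (𝔷.map Ψ) hPbot hΨx
    obtain ⟨s, rfl⟩ := hΨ σ
    refine ⟨s, fun hs => hσ (Ideal.mem_map_of_mem Ψ hs), hker𝔶 ?_⟩
    rw [RingHom.mem_ker, map_mul, hσx]
  -- Matsumura 23.7 (ii) for `B_𝔶 → T_𝔷`
  set f := Localization.localRingHom 𝔶 𝔷 (algebraMap B T) h𝔶 with hfdef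
  have hflatBT : (algebraMap B T).Flat := RingHom.flat_algebraMap_iff.mpr inferInstance
  have hf : f.Flat := hflatBT.localRingHom 𝔷 𝔶 h𝔶
  letI : Algebra (Localization.AtPrime 𝔶) (Localization.AtPrime 𝔷) := f.toAlgebra
  haveI : Module.Flat (Localization.AtPrime 𝔶) (Localization.AtPrime 𝔷) := hf
  haveI : IsLocalHom (algebraMap (Localization.AtPrime 𝔶) (Localization.AtPrime 𝔷)) :=
    Localization.isLocalHom_localRingHom 𝔶 𝔷 (algebraMap B T) h𝔶
  haveI := hreg
  refine IsRegularLocalRing.of_flat_of_map_maximalIdeal_eq (Localization.AtPrime 𝔶)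
    (Localization.AtPrime 𝔷) ?_
  change (maximalIdeal (Localization.AtPrime 𝔶)).map f = maximalIdeal (Localization.AtPrime 𝔷)
  rw [← Localization.AtPrime.map_eq_maximalIdeal, ← Localization.AtPrime.map_eq_maximalIdeal,
    Ideal.map_map]
  have hcomp : f.comp (algebraMap B (Localization.AtPrime 𝔶)) =
      (algebraMap T (Localization.AtPrime 𝔷)).comp (algebraMap B T) := by
    ext b
    exact Localization.localRingHom_to_map 𝔶 𝔷 (algebraMap B T) h𝔶 b
  rw [hcomp, ← Ideal.map_map]
  refine le_antisymm (Ideal.map_mono (Ideal.map_le_iff_le_comap.mpr le_rfl))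
    (Ideal.map_le_iff_le_comap.mpr fun x hx => ?_)
  obtain ⟨s, hs, hsx⟩ := key x hx
  rw [Ideal.mem_comap]
  have hunit : IsUnit (algebraMap T (Localization.AtPrime 𝔷) s) :=
    IsLocalization.map_units (Localization.AtPrime 𝔷) (⟨s, hs⟩ : 𝔷.primeCompl)
  obtain ⟨v, hv⟩ := hunit.exists_left_inv
  have hsx' : algebraMap T (Localization.AtPrime 𝔷) (s * x) ∈
      (𝔶.map (algebraMap B T)).map (algebraMap T (Localization.AtPrime 𝔷)) :=
    Ideal.mem_map_of_mem _ hsx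
  have : algebraMap T (Localization.AtPrime 𝔷) x =
      v * algebraMap T (Localization.AtPrime 𝔷) (s * x) := by
    rw [map_mul, ← mul_assoc, hv, one_mul]
  rw [this]
  exact Ideal.mul_mem_left _ _ hsx'

end Literature.AlgebraicGeometry.Resolution

end
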